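import Summits.AtomisticToContinuum.HydrodynamicLimit.Theorems.MourreKoopmanChargesLinearToEntropyInBandWindowClauseCovering
import HarnessLib

/-!
# Route `MourreKoopmanCharges`, crux `LinearToEntropyInBand` (stmt-AtomisticToContinuum-17740), skeleton v8:
# stub 4a-ii, the cone-smoothing commutator (plan § 1 (3) D3 `Smooth`)

Support file (`--supports stmt-AtomisticToContinuum-17740`; registered helper `stub_windowClauseSmoothing`; worker of lead
prover-line-…-17740-c6-0, wave 1; plan `Cruxes/LinearToEntropyInBand/WINDOWCLAUSE-PLAN.md` § 1 (3) D3, § 3).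

In Yau's one-window bookkeeping (stub 4a-ii) the entropy variables `∇λ_s` (smooth on `𝕋³`) are paired once against the
EMPIRICAL visible fields `(N+1)⁻¹ Σ_{i visible} δ_{xᵢ} ⊗ (1, vᵢ, ‖vᵢ‖²/2)` and once against their cone-SMOOTHED versions,
the visible block fields `visDensityN / visMomentumN / visEnergyN` of DefsB (e),
`(N+1)⁻¹ Σᵢ 𝟙[VisibleN] cone k N x xᵢ · (1, vᵢ, ‖vᵢ‖²/2)` (`cone k N x y = 3/(π (kν)³) (1 − euclidDist x y/(kν))₊`,
`ν = (N+1)^{-1/3}`, unit mass, support radius `kν`).  The difference — the smoothing commutator, term D3 `Smooth` of the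
plan — is DETERMINISTICALLY small: `≤ Lip(g) · kν · (visible content)`.  This file proves it:

* § 2 `abs_integral_mul_cone_sub_le`: ONE particle, `|∫ φ(x) cone k N x q dx − φ(q)| ≤ ω` whenever `|φ x − φ q| ≤ ω` on
  the support `euclidDist x q < kν` (`0 < kν < 1/2`; `∫ cone k N · q = 1` by `integral_cone_eq_one`, `cone ≥ 0`,
  `cone = 0` off the support, `cone_eq_zero_of_le`); `abs_integral_sum_mul_cone_sub_le`: finitely many particles.
* § 3 `abs_integral_mul_sum_cone_sub_le` (scalar pairing) and `abs_integral_inner_sum_cone_smul_sub_le` (vector pairing,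
  any real inner product space): for `|g x − g y| ≤ Lg · euclidDist x y`,
  `|∫ g Σᵢ cᵢ cone(·, qᵢ) − Σᵢ cᵢ g(qᵢ)| ≤ Lg · kν · Σᵢ |cᵢ|`.
* § 4 the instantiations to the visible block density (`≤ Lg kν (N+1)⁻¹ #{visible} ≤ Lg kν`), momentum
  (`≤ Lg kν (N+1)⁻¹ Σ_vis ‖vᵢ‖`) and kinetic energy (`≤ Lg kν (N+1)⁻¹ Σ_vis ‖vᵢ‖²/2`) at EVERY configuration.

Elementary (Lipschitz test function against a unit-mass nonnegative mollifier of support radius `kν`); nothing here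
restates the crux, a stub, a neighbour's stub or the Statement.  References: C. Kipnis, C. Landim, *Scaling Limits of
Interacting Particle Systems* (1999), Ch. 5 § 1 (block averages as the mollification `π^N * ι_ε` of the empirical measure,
around Lemma 1.10); H.-T. Yau, Lett. Math. Phys. 22 (1991) § 2.
-/
noncomputable section

open MeasureTheory Filter Set Metric
open scoped ENNReal Topology InnerProductSpace BigOperators

namespace Summit.AtomisticToContinuum.HydrodynamicLimit.Theorems.LTEInBand

open Literature.MathematicalPhysics.KineticTheory Literature.Analysis.FluidPDE Literature.Analysis.FunctionSpaces
open Summit.AtomisticToContinuum.HydrodynamicLimit.Theorems.ShearStressHalfDrudeFrozenGlueHelpers (dist_le_euclidDist)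

/-! ## § 1 The cone kernel in its first variable: continuity, integrability; euclidDist-Lipschitz maps -/

section Kernel

variable {N : ℕ}

/-- The cone kernel is continuous in its first variable. -/
theorem continuous_cone_left (k : ℝ) (y : T3) : Continuous fun x : T3 => cone k N x y := by
  unfold cone
  exact continuous_const.mul (continuous_const.max (continuous_const.sub
    ((Torus.continuous_euclidDist.comp (continuous_id.prodMk continuous_const)).div_const _)))

/-- The cone kernel is integrable over `𝕋³` in its first variable. -/
theorem integrable_cone_left (k : ℝ) (y : T3) : Integrable fun x : T3 => cone k N x y :=
  (continuous_cone_left k y).integrable_of_hasCompactSupport (HasCompactSupport.of_compactSpace _)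

/-- A map of `𝕋³` into a normed group which is Lipschitz for the minimal-image Euclidean distance is continuous
(`euclidDist ≤ 2 dist`, `euclidDist_le_two_mul_dist`). -/
theorem continuous_of_norm_sub_le_euclidDist {E : Type*} [NormedAddCommGroup E] {g : T3 → E} {Lg : ℝ} (hLg : 0 ≤ Lg)
    (hLip : ∀ x y, ‖g x - g y‖ ≤ Lg * Torus.euclidDist x y) : Continuous g := by
  have hL : LipschitzWith ⟨2 * Lg, by positivity⟩ g := LipschitzWith.of_dist_le_mul fun x y => by
    rw [dist_eq_norm]
    calc ‖g x - g y‖ ≤ Lg * Torus.euclidDist x y := hLip x y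
      _ ≤ Lg * (2 * dist x y) := mul_le_mul_of_nonneg_left (euclidDist_le_two_mul_dist x y) hLg
      _ = ((⟨2 * Lg, by positivity⟩ : NNReal) : ℝ) * dist x y := by push_cast; ring
  exact hL.continuous

end Kernel

/-! ## § 2 One particle: the smoothing error against a test function is its oscillation on the support -/

section OneParticle

variable {N : ℕ}

/-- **One particle.** For `0 < kν < 1/2` (`ν = (N+1)^{-1/3}`, so that `∫ cone k N · q = 1`), a continuous `φ` and a
point `q`: `|∫ φ(x) cone k N x q dx − φ(q)| ≤ ω` as soon as `|φ x − φ q| ≤ ω` on the support `euclidDist x q < kν`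
(`∫ φ cone − φ(q) = ∫ (φ − φ(q)) cone`, `cone ≥ 0`, `cone = 0` off the support). -/
theorem abs_integral_mul_cone_sub_le {k : ℝ} (hk : 0 < k * ((N : ℝ) + 1) ^ (-(1 / 3 : ℝ)))
    (hk2 : k * ((N : ℝ) + 1) ^ (-(1 / 3 : ℝ)) < 1 / 2) {φ : T3 → ℝ} (hφ : Continuous φ) (q : T3) {ω : ℝ}
    (hω : ∀ x, Torus.euclidDist x q < k * ((N : ℝ) + 1) ^ (-(1 / 3 : ℝ)) → |φ x - φ q| ≤ ω) :
    |(∫ x, φ x * cone k N x q) - φ q| ≤ ω := by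
  have hk0 : 0 < k := pos_of_mul_pos_left hk (Real.rpow_nonneg (by positivity) _)
  have hint : Integrable fun x : T3 => φ x * cone k N x q :=
    (hφ.mul (continuous_cone_left k q)).integrable_of_hasCompactSupport (HasCompactSupport.of_compactSpace _)
  have h1 : ∫ x, (φ x - φ q) * cone k N x q = (∫ x, φ x * cone k N x q) - φ q := by
    simp_rw [sub_mul]
    rw [integral_sub hint ((integrable_cone_left k q).const_mul (φ q)), integral_const_mul,
      integral_cone_eq_one N hk hk2 q, mul_one]
  rw [← h1, ← Real.norm_eq_abs]
  calc ‖∫ x, (φ x - φ q) * cone k N x q‖ ≤ ∫ x, ω * cone k N x q :=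
        norm_integral_le_of_norm_le ((integrable_cone_left k q).const_mul ω) (ae_of_all _ fun x => by
          rw [Real.norm_eq_abs, abs_mul, abs_of_nonneg (cone_nonneg N hk0.le x q)]
          by_cases hd : Torus.euclidDist x q < k * ((N : ℝ) + 1) ^ (-(1 / 3 : ℝ))
          · exact mul_le_mul_of_nonneg_right (hω x hd) (cone_nonneg N hk0.le x q)
          · rw [cone_eq_zero_of_le hk (not_lt.1 hd), mul_zero, mul_zero])
    _ = ω := by rw [integral_const_mul, integral_cone_eq_one N hk hk2 q, mul_one]

/-- **Finitely many particles.** `|∫ Σᵢ φᵢ(x) cone k N x qᵢ dx − Σᵢ φᵢ(qᵢ)| ≤ Σᵢ ωᵢ` for continuous `φᵢ` with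
`|φᵢ x − φᵢ qᵢ| ≤ ωᵢ` on `euclidDist x qᵢ < kν` (swap the finite sum and the integral, `abs_integral_mul_cone_sub_le`). -/
theorem abs_integral_sum_mul_cone_sub_le {ι : Type*} [Fintype ι] {k : ℝ} (hk : 0 < k * ((N : ℝ) + 1) ^ (-(1 / 3 : ℝ)))
    (hk2 : k * ((N : ℝ) + 1) ^ (-(1 / 3 : ℝ)) < 1 / 2) {φ : ι → T3 → ℝ} (hφ : ∀ i, Continuous (φ i)) (q : ι → T3)
    {ω : ι → ℝ} (hω : ∀ i x, Torus.euclidDist x (q i) < k * ((N : ℝ) + 1) ^ (-(1 / 3 : ℝ)) → |φ i x - φ i (q i)| ≤ ω i) :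
    |(∫ x, ∑ i, φ i x * cone k N x (q i)) - ∑ i, φ i (q i)| ≤ ∑ i, ω i := by
  rw [integral_finsetSum Finset.univ (f := fun i x => φ i x * cone k N x (q i)) fun i _ =>
    ((hφ i).mul (continuous_cone_left k (q i))).integrable_of_hasCompactSupport (HasCompactSupport.of_compactSpace _),
    ← Finset.sum_sub_distrib]
  exact (Finset.abs_sum_le_sum_abs _ _).trans (Finset.sum_le_sum fun i _ => abs_integral_mul_cone_sub_le hk hk2 (hφ i) (q i) (hω i))

end OneParticle

/-! ## § 3 Lipschitz test functions: the scalar and the vector commutator -/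

section Lipschitz

variable {N : ℕ} {ι : Type*} [Fintype ι]

/-- **The cone-smoothing commutator, scalar pairing.** For `0 < kν < 1/2`, a test function `g` with
`|g x − g y| ≤ Lg · euclidDist x y` (`0 ≤ Lg`), weights `cᵢ` and positions `qᵢ`:
`|∫ g(x) Σᵢ cᵢ cone k N x qᵢ dx − Σᵢ cᵢ g(qᵢ)| ≤ Lg · kν · Σᵢ |cᵢ|` — replacing the point masses by their cone-smoothings
costs the Lipschitz constant times the smoothing radius times the total variation of the weights. -/
theorem abs_integral_mul_sum_cone_sub_le {k : ℝ} (hk : 0 < k * ((N : ℝ) + 1) ^ (-(1 / 3 : ℝ)))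
    (hk2 : k * ((N : ℝ) + 1) ^ (-(1 / 3 : ℝ)) < 1 / 2) {g : T3 → ℝ} {Lg : ℝ} (hLg : 0 ≤ Lg)
    (hLip : ∀ x y, |g x - g y| ≤ Lg * Torus.euclidDist x y) (c : ι → ℝ) (q : ι → T3) :
    |(∫ x, g x * ∑ i, c i * cone k N x (q i)) - ∑ i, c i * g (q i)| ≤
      Lg * (k * ((N : ℝ) + 1) ^ (-(1 / 3 : ℝ))) * ∑ i, |c i| := by
  have hg : Continuous g :=
    continuous_of_norm_sub_le_euclidDist hLg fun x y => by rw [Real.norm_eq_abs]; exact hLip x y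
  have h := abs_integral_sum_mul_cone_sub_le hk hk2 (φ := fun i x => c i * g x) (fun i => continuous_const.mul hg) q
    (ω := fun i => Lg * (k * ((N : ℝ) + 1) ^ (-(1 / 3 : ℝ))) * |c i|) fun i x hx => by
      rw [← mul_sub, abs_mul, mul_comm]
      refine mul_le_mul_of_nonneg_right ((hLip x (q i)).trans ?_) (abs_nonneg _)
      exact mul_le_mul_of_nonneg_left hx.le hLg
  have hfun : (fun x => g x * ∑ i, c i * cone k N x (q i)) = fun x => ∑ i, c i * g x * cone k N x (q i) := by
    funext x
    rw [Finset.mul_sum]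
    exact Finset.sum_congr rfl fun i _ => by ring
  rw [hfun, Finset.mul_sum]
  exact h

/-- **The cone-smoothing commutator, vector pairing.** For `0 < kν < 1/2`, a test field `g` into a real inner product
space with `‖g x − g y‖ ≤ Lg · euclidDist x y` (`0 ≤ Lg`), vector weights `cᵢ` and positions `qᵢ`:
`|∫ ⟪g(x), Σᵢ cone k N x qᵢ • cᵢ⟫ dx − Σᵢ ⟪g(qᵢ), cᵢ⟫| ≤ Lg · kν · Σᵢ ‖cᵢ‖`. -/
theorem abs_integral_inner_sum_cone_smul_sub_le {E : Type*} [NormedAddCommGroup E] [InnerProductSpace ℝ E] {k : ℝ}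
    (hk : 0 < k * ((N : ℝ) + 1) ^ (-(1 / 3 : ℝ))) (hk2 : k * ((N : ℝ) + 1) ^ (-(1 / 3 : ℝ)) < 1 / 2) {g : T3 → E}
    {Lg : ℝ} (hLg : 0 ≤ Lg) (hLip : ∀ x y, ‖g x - g y‖ ≤ Lg * Torus.euclidDist x y) (c : ι → E) (q : ι → T3) :
    |(∫ x, ⟪g x, ∑ i, cone k N x (q i) • c i⟫_ℝ) - ∑ i, ⟪g (q i), c i⟫_ℝ| ≤
      Lg * (k * ((N : ℝ) + 1) ^ (-(1 / 3 : ℝ))) * ∑ i, ‖c i‖ := by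
  have hg : Continuous g := continuous_of_norm_sub_le_euclidDist hLg hLip
  have h := abs_integral_sum_mul_cone_sub_le hk hk2 (φ := fun i x => ⟪g x, c i⟫_ℝ) (fun i => hg.inner continuous_const) q
    (ω := fun i => Lg * (k * ((N : ℝ) + 1) ^ (-(1 / 3 : ℝ))) * ‖c i‖) fun i x hx => by
      rw [← inner_sub_left]
      refine (abs_real_inner_le_norm _ _).trans (mul_le_mul_of_nonneg_right ((hLip x (q i)).trans ?_) (norm_nonneg _))
      exact mul_le_mul_of_nonneg_left hx.le hLg
  have hfun : (fun x => ⟪g x, ∑ i, cone k N x (q i) • c i⟫_ℝ) = fun x => ∑ i, ⟪g x, c i⟫_ℝ * cone k N x (q i) := by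
    funext x
    rw [inner_sum]
    exact Finset.sum_congr rfl fun i _ => by rw [real_inner_smul_right, mul_comm]
  rw [hfun, Finset.mul_sum]
  exact h

end Lipschitz

/-! ## § 4 The visible block fields of DefsB (e) against their empirical point masses -/

section Visible

variable {N : ℕ} {ρs : T3 → ℝ} {us : T3 → V3} {R K : ℝ}

/-- **Smoothing commutator of the visible block DENSITY.** For `0 < kν < 1/2` and a test function `g` with
`|g x − g y| ≤ Lg · euclidDist x y` (`0 ≤ Lg`), at every configuration `z`:
`|∫ g ρ̄_vis − (N+1)⁻¹ Σ_{i visible} g(xᵢ)| ≤ Lg · kν · (N+1)⁻¹ #{visible}`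
(`visDensityN … z x = (N+1)⁻¹ Σᵢ 𝟙[visible i] cone k N x xᵢ`; `abs_integral_mul_sum_cone_sub_le` with the weights
`(N+1)⁻¹ 𝟙[visible i]`). -/
theorem abs_integral_mul_visDensityN_sub_le {k : ℝ} (hk : 0 < k * ((N : ℝ) + 1) ^ (-(1 / 3 : ℝ)))
    (hk2 : k * ((N : ℝ) + 1) ^ (-(1 / 3 : ℝ)) < 1 / 2) {g : T3 → ℝ} {Lg : ℝ} (hLg : 0 ≤ Lg)
    (hLip : ∀ x y, |g x - g y| ≤ Lg * Torus.euclidDist x y) (z : Config (N + 1) (Fin 3) T3) :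
    |(∫ x, g x * visDensityN ρs us R K k N z x) - ((N : ℝ) + 1)⁻¹ * ∑ i, (if VisibleN ρs us R K N z i then g (z i).1 else 0)| ≤
      Lg * (k * ((N : ℝ) + 1) ^ (-(1 / 3 : ℝ))) * (((N : ℝ) + 1)⁻¹ * ∑ i, (if VisibleN ρs us R K N z i then (1 : ℝ) else 0)) := by
  have h := abs_integral_mul_sum_cone_sub_le hk hk2 hLg hLip
    (fun i => ((N : ℝ) + 1)⁻¹ * (if VisibleN ρs us R K N z i then (1 : ℝ) else 0)) fun i => (z i).1
  have h1 : ∀ x, g x * visDensityN ρs us R K k N z x =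
      g x * ∑ i, ((N : ℝ) + 1)⁻¹ * (if VisibleN ρs us R K N z i then (1 : ℝ) else 0) * cone k N x (z i).1 := fun x => by
    unfold visDensityN
    rw [Finset.mul_sum]
    congr 1
    refine Finset.sum_congr rfl fun i _ => ?_
    split_ifs <;> ring
  have h2 : ((N : ℝ) + 1)⁻¹ * ∑ i, (if VisibleN ρs us R K N z i then g (z i).1 else 0) =
      ∑ i, ((N : ℝ) + 1)⁻¹ * (if VisibleN ρs us R K N z i then (1 : ℝ) else 0) * g (z i).1 := by
    rw [Finset.mul_sum]
    refine Finset.sum_congr rfl fun i _ => ?_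
    split_ifs <;> ring
  have h3 : ((N : ℝ) + 1)⁻¹ * ∑ i, (if VisibleN ρs us R K N z i then (1 : ℝ) else 0) =
      ∑ i, |((N : ℝ) + 1)⁻¹ * (if VisibleN ρs us R K N z i then (1 : ℝ) else 0)| := by
    rw [Finset.mul_sum]
    refine Finset.sum_congr rfl fun i _ => ?_
    rw [abs_of_nonneg]
    split_ifs <;> positivity
  simp_rw [h1]
  rw [h2, h3]
  exact h

/-- **Smoothing commutator of the visible block density, crude form**: the visible fraction is at most `1`, so the
error is at most `Lg · kν`. -/
theorem abs_integral_mul_visDensityN_sub_le' {k : ℝ} (hk : 0 < k * ((N : ℝ) + 1) ^ (-(1 / 3 : ℝ)))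
    (hk2 : k * ((N : ℝ) + 1) ^ (-(1 / 3 : ℝ)) < 1 / 2) {g : T3 → ℝ} {Lg : ℝ} (hLg : 0 ≤ Lg)
    (hLip : ∀ x y, |g x - g y| ≤ Lg * Torus.euclidDist x y) (z : Config (N + 1) (Fin 3) T3) :
    |(∫ x, g x * visDensityN ρs us R K k N z x) - ((N : ℝ) + 1)⁻¹ * ∑ i, (if VisibleN ρs us R K N z i then g (z i).1 else 0)| ≤
      Lg * (k * ((N : ℝ) + 1) ^ (-(1 / 3 : ℝ))) := by
  refine (abs_integral_mul_visDensityN_sub_le hk hk2 hLg hLip z).trans (mul_le_of_le_one_right (mul_nonneg hLg hk.le) ?_)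
  have hN : (0 : ℝ) < (N : ℝ) + 1 := by positivity
  rw [inv_mul_le_iff₀ hN, mul_one]
  calc ∑ i, (if VisibleN ρs us R K N z i then (1 : ℝ) else 0) ≤ ∑ _i : Fin (N + 1), (1 : ℝ) :=
        Finset.sum_le_sum fun i _ => by split_ifs <;> norm_num
    _ = (N : ℝ) + 1 := by
        rw [Finset.sum_const, Finset.card_univ, Fintype.card_fin, nsmul_eq_mul, mul_one]
        push_cast
        rfl

/-- **Smoothing commutator of the visible block MOMENTUM.** For `0 < kν < 1/2` and a test field `g : 𝕋³ → ℝ³` with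
`‖g x − g y‖ ≤ Lg · euclidDist x y` (`0 ≤ Lg`), at every configuration `z`:
`|∫ ⟪g, m̄_vis⟫ − (N+1)⁻¹ Σ_{i visible} ⟪g(xᵢ), vᵢ⟫| ≤ Lg · kν · (N+1)⁻¹ Σ_{i visible} ‖vᵢ‖`
(`visMomentumN … z x = (N+1)⁻¹ Σᵢ 𝟙[visible i] cone k N x xᵢ • vᵢ`; `abs_integral_inner_sum_cone_smul_sub_le`). -/
theorem abs_integral_inner_visMomentumN_sub_le {k : ℝ} (hk : 0 < k * ((N : ℝ) + 1) ^ (-(1 / 3 : ℝ)))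
    (hk2 : k * ((N : ℝ) + 1) ^ (-(1 / 3 : ℝ)) < 1 / 2) {g : T3 → V3} {Lg : ℝ} (hLg : 0 ≤ Lg)
    (hLip : ∀ x y, ‖g x - g y‖ ≤ Lg * Torus.euclidDist x y) (z : Config (N + 1) (Fin 3) T3) :
    |(∫ x, ⟪g x, visMomentumN ρs us R K k N z x⟫_ℝ) -
        ((N : ℝ) + 1)⁻¹ * ∑ i, (if VisibleN ρs us R K N z i then ⟪g (z i).1, (z i).2⟫_ℝ else 0)| ≤
      Lg * (k * ((N : ℝ) + 1) ^ (-(1 / 3 : ℝ))) * (((N : ℝ) + 1)⁻¹ * ∑ i, (if VisibleN ρs us R K N z i then ‖(z i).2‖ else 0)) := by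
  have h := abs_integral_inner_sum_cone_smul_sub_le hk hk2 hLg hLip
    (fun i => ((N : ℝ) + 1)⁻¹ • (if VisibleN ρs us R K N z i then (z i).2 else (0 : V3))) fun i => (z i).1
  have h1 : ∀ x, visMomentumN ρs us R K k N z x =
      ∑ i, cone k N x (z i).1 • (((N : ℝ) + 1)⁻¹ • (if VisibleN ρs us R K N z i then (z i).2 else (0 : V3))) := fun x => by
    unfold visMomentumN
    rw [Finset.smul_sum]
    refine Finset.sum_congr rfl fun i _ => ?_
    split_ifs
    · exact smul_comm _ _ _
    · simp only [smul_zero]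
  have h2 : ((N : ℝ) + 1)⁻¹ * ∑ i, (if VisibleN ρs us R K N z i then ⟪g (z i).1, (z i).2⟫_ℝ else 0) =
      ∑ i, ⟪g (z i).1, ((N : ℝ) + 1)⁻¹ • (if VisibleN ρs us R K N z i then (z i).2 else (0 : V3))⟫_ℝ := by
    rw [Finset.mul_sum]
    refine Finset.sum_congr rfl fun i _ => ?_
    rw [real_inner_smul_right]
    split_ifs
    · rfl
    · rw [inner_zero_right]
  have h3 : ((N : ℝ) + 1)⁻¹ * ∑ i, (if VisibleN ρs us R K N z i then ‖(z i).2‖ else 0) =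
      ∑ i, ‖((N : ℝ) + 1)⁻¹ • (if VisibleN ρs us R K N z i then (z i).2 else (0 : V3))‖ := by
    rw [Finset.mul_sum]
    refine Finset.sum_congr rfl fun i _ => ?_
    rw [norm_smul, norm_inv, Real.norm_of_nonneg (by positivity : (0 : ℝ) ≤ (N : ℝ) + 1)]
    split_ifs
    · rfl
    · rw [norm_zero]
  simp_rw [h1]
  rw [h2, h3]
  exact h

/-- **Smoothing commutator of the visible block KINETIC ENERGY.** For `0 < kν < 1/2` and a test function `g` with
`|g x − g y| ≤ Lg · euclidDist x y` (`0 ≤ Lg`), at every configuration `z`: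
`|∫ g ē_vis − (N+1)⁻¹ Σ_{i visible} g(xᵢ) ‖vᵢ‖²/2| ≤ Lg · kν · (N+1)⁻¹ Σ_{i visible} ‖vᵢ‖²/2`
(`visEnergyN … z x = (N+1)⁻¹ Σᵢ 𝟙[visible i] cone k N x xᵢ ‖vᵢ‖²/2`; `abs_integral_mul_sum_cone_sub_le`). -/
theorem abs_integral_mul_visEnergyN_sub_le {k : ℝ} (hk : 0 < k * ((N : ℝ) + 1) ^ (-(1 / 3 : ℝ)))
    (hk2 : k * ((N : ℝ) + 1) ^ (-(1 / 3 : ℝ)) < 1 / 2) {g : T3 → ℝ} {Lg : ℝ} (hLg : 0 ≤ Lg)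
    (hLip : ∀ x y, |g x - g y| ≤ Lg * Torus.euclidDist x y) (z : Config (N + 1) (Fin 3) T3) :
    |(∫ x, g x * visEnergyN ρs us R K k N z x) -
        ((N : ℝ) + 1)⁻¹ * ∑ i, (if VisibleN ρs us R K N z i then g (z i).1 * ‖(z i).2‖ ^ 2 / 2 else 0)| ≤
      Lg * (k * ((N : ℝ) + 1) ^ (-(1 / 3 : ℝ))) *
        (((N : ℝ) + 1)⁻¹ * ∑ i, (if VisibleN ρs us R K N z i then ‖(z i).2‖ ^ 2 / 2 else 0)) := by
  have h := abs_integral_mul_sum_cone_sub_le hk hk2 hLg hLip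
    (fun i => ((N : ℝ) + 1)⁻¹ * (if VisibleN ρs us R K N z i then ‖(z i).2‖ ^ 2 / 2 else 0)) fun i => (z i).1
  have h1 : ∀ x, g x * visEnergyN ρs us R K k N z x =
      g x * ∑ i, ((N : ℝ) + 1)⁻¹ * (if VisibleN ρs us R K N z i then ‖(z i).2‖ ^ 2 / 2 else 0) * cone k N x (z i).1 :=
    fun x => by
    unfold visEnergyN
    rw [Finset.mul_sum]
    congr 1
    refine Finset.sum_congr rfl fun i _ => ?_
    split_ifs <;> ring
  have h2 : ((N : ℝ) + 1)⁻¹ * ∑ i, (if VisibleN ρs us R K N z i then g (z i).1 * ‖(z i).2‖ ^ 2 / 2 else 0) =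
      ∑ i, ((N : ℝ) + 1)⁻¹ * (if VisibleN ρs us R K N z i then ‖(z i).2‖ ^ 2 / 2 else 0) * g (z i).1 := by
    rw [Finset.mul_sum]
    refine Finset.sum_congr rfl fun i _ => ?_
    split_ifs <;> ring
  have h3 : ((N : ℝ) + 1)⁻¹ * ∑ i, (if VisibleN ρs us R K N z i then ‖(z i).2‖ ^ 2 / 2 else 0) =
      ∑ i, |((N : ℝ) + 1)⁻¹ * (if VisibleN ρs us R K N z i then ‖(z i).2‖ ^ 2 / 2 else 0)| := by
    rw [Finset.mul_sum]
    refine Finset.sum_congr rfl fun i _ => ?_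
    rw [abs_of_nonneg]
    split_ifs <;> positivity
  simp_rw [h1]
  rw [h2, h3]
  exact h

end Visible

/-! ## The registered helper stub -/

/-- **Registered helper stub `stub_windowClauseSmoothing` (plan § 1 (3) D3 "cone-smoothing commutator" of stub 4a-ii,
skeleton v8, crux stmt-17740)**: sorry-free conjunction, restated with fully qualified names (the registered one-line
signature), of the scalar and vector commutator estimates `abs_integral_mul_sum_cone_sub_le`,
`abs_integral_inner_sum_cone_smul_sub_le` (§ 3) and their instantiations to the visible block density (crude form
`abs_integral_mul_visDensityN_sub_le'`, through which the fine form is reached), kinetic energy and momentum of DefsB (e)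
(§ 4). -/
theorem stub_windowClauseSmoothing : (∀ (N : ℕ) (k : ℝ), 0 < k * ((N : ℝ) + 1) ^ (-(1 / 3 : ℝ)) → k * ((N : ℝ) + 1) ^ (-(1 / 3 : ℝ)) < 1 / 2 → ∀ (g : Literature.MathematicalPhysics.KineticTheory.T3 → ℝ) (Lg : ℝ), 0 ≤ Lg → (∀ x y, |g x - g y| ≤ Lg * Literature.Analysis.FluidPDE.Torus.euclidDist x y) → ∀ (c : Fin (N + 1) → ℝ) (q : Fin (N + 1) → Literature.MathematicalPhysics.KineticTheory.T3), |(∫ x, g x * ∑ i, c i * Summit.AtomisticToContinuum.HydrodynamicLimit.Theorems.LTEInBand.cone k N x (q i)) - ∑ i, c i * g (q i)| ≤ Lg * (k * ((N : ℝ) + 1) ^ (-(1 / 3 : ℝ))) * ∑ i, |c i|) ∧ (∀ (N : ℕ) (k : ℝ), 0 < k * ((N : ℝ) + 1) ^ (-(1 / 3 : ℝ)) → k * ((N : ℝ) + 1) ^ (-(1 / 3 : ℝ)) < 1 / 2 → ∀ (g : Literature.MathematicalPhysics.KineticTheory.T3 → Literature.MathematicalPhysics.KineticTheory.V3) (Lg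 : ℝ), 0 ≤ Lg → (∀ x y, ‖g x - g y‖ ≤ Lg * Literature.Analysis.FluidPDE.Torus.euclidDist x y) → ∀ (c : Fin (N + 1) → Literature.MathematicalPhysics.KineticTheory.V3) (q : Fin (N + 1) → Literature.MathematicalPhysics.KineticTheory.T3), |(∫ x, inner ℝ (g x) (∑ i, Summit.AtomisticToContinuum.HydrodynamicLimit.Theorems.LTEInBand.cone k N x (q i) • c i)) - ∑ i, inner ℝ (g (q i)) (c i)| ≤ Lg * (k * ((N : ℝ) + 1) ^ (-(1 / 3 : ℝ))) * ∑ i, ‖c i‖) ∧ (∀ (N : ℕ) (ρs : Literature.MathematicalPhysics.KineticTheory.T3 → ℝ) (us : Literature.MathematicalPhysics.KineticTheory.T3 → Literature.MathematicalPhysics.KineticTheory.V3) (R K k : ℝ), 0 < k * ((N : ℝ) + 1) ^ (-(1 / 3 : ℝ)) → k * ((N : ℝ) + 1) ^ (-(1 / 3 : ℝ)) < 1 / 2 → ∀ (g : Literature.MathematicalPhysics.KineticTheory.T3 → ℝ) (Lg : ℝ), 0 ≤ Lg → (∀ x y, |g x - g y| ≤ Lg * Literature.Analysis.FluidPDE.Torus.euclidDist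 x y) → ∀ z : Literature.Analysis.FluidPDE.Config (N + 1) (Fin 3) Literature.MathematicalPhysics.KineticTheory.T3, |(∫ x, g x * Summit.AtomisticToContinuum.HydrodynamicLimit.Theorems.LTEInBand.visDensityN ρs us R K k N z x) - ((N : ℝ) + 1)⁻¹ * ∑ i, (if Summit.AtomisticToContinuum.HydrodynamicLimit.Theorems.LTEInBand.VisibleN ρs us R K N z i then g (z i).1 else 0)| ≤ Lg * (k * ((N : ℝ) + 1) ^ (-(1 / 3 : ℝ))) ∧ |(∫ x, g x * Summit.AtomisticToContinuum.HydrodynamicLimit.Theorems.LTEInBand.visEnergyN ρs us R K k N z x) - ((N : ℝ) + 1)⁻¹ * ∑ i, (if Summit.AtomisticToContinuum.HydrodynamicLimit.Theorems.LTEInBand.VisibleN ρs us R K N z i then g (z i).1 * ‖(z i).2‖ ^ 2 / 2 else 0)| ≤ Lg * (k * ((N : ℝ) + 1) ^ (-(1 / 3 : ℝ))) * (((N : ℝ) + 1)⁻¹ * ∑ i, (if Summit.AtomisticToContinuum.HydrodynamicLimit.Theorems.LTEInBand.VisibleN ρs us R K N z i then ‖(z i).2‖ ^ 2 / 2 else 0)))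 ∧ (∀ (N : ℕ) (ρs : Literature.MathematicalPhysics.KineticTheory.T3 → ℝ) (us : Literature.MathematicalPhysics.KineticTheory.T3 → Literature.MathematicalPhysics.KineticTheory.V3) (R K k : ℝ), 0 < k * ((N : ℝ) + 1) ^ (-(1 / 3 : ℝ)) → k * ((N : ℝ) + 1) ^ (-(1 / 3 : ℝ)) < 1 / 2 → ∀ (g : Literature.MathematicalPhysics.KineticTheory.T3 → Literature.MathematicalPhysics.KineticTheory.V3) (Lg : ℝ), 0 ≤ Lg → (∀ x y, ‖g x - g y‖ ≤ Lg * Literature.Analysis.FluidPDE.Torus.euclidDist x y) → ∀ z : Literature.Analysis.FluidPDE.Config (N + 1) (Fin 3) Literature.MathematicalPhysics.KineticTheory.T3, |(∫ x, inner ℝ (g x) (Summit.AtomisticToContinuum.HydrodynamicLimit.Theorems.LTEInBand.visMomentumN ρs us R K k N z x)) - ((N : ℝ) + 1)⁻¹ * ∑ i, (if Summit.AtomisticToContinuum.HydrodynamicLimit.Theorems.LTEInBand.VisibleN ρs us R K N z i then inner ℝ (g (z i).1) (z i).2 else 0)| ≤ Lg * (k * ((N : ℝ) + 1) ^ (-(1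 / 3 : ℝ))) * (((N : ℝ) + 1)⁻¹ * ∑ i, (if Summit.AtomisticToContinuum.HydrodynamicLimit.Theorems.LTEInBand.VisibleN ρs us R K N z i then ‖(z i).2‖ else 0))) :=
  ⟨fun _ _ hk hk2 _ _ hLg hLip c q => abs_integral_mul_sum_cone_sub_le hk hk2 hLg hLip c q,
    fun _ _ hk hk2 _ _ hLg hLip c q => abs_integral_inner_sum_cone_smul_sub_le hk hk2 hLg hLip c q,
    fun _ _ _ _ _ _ hk hk2 _ _ hLg hLip z =>
      ⟨abs_integral_mul_visDensityN_sub_le' hk hk2 hLg hLip z, abs_integral_mul_visEnergyN_sub_le hk hk2 hLg hLip z⟩,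
    fun _ _ _ _ _ _ hk hk2 _ _ hLg hLip z => abs_integral_inner_visMomentumN_sub_le hk hk2 hLg hLip z⟩

end Summit.AtomisticToContinuum.HydrodynamicLimit.Theorems.LTEInBand

end
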